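import Mathlib.Analysis.Calculus.MeanValue
import Mathlib.Analysis.Complex.RealDeriv
import Mathlib.Topology.MetricSpace.Contracting
import Mathlib.Analysis.Complex.CauchyIntegral
import Mathlib.Analysis.Normed.Module.Convex

/-!
# Helper `helper_univalentOfDecay` of line `Sketch` (pencil-incompleteness) for crux `WitnessCharge`
(item stmt-SmoothPoincare4-7824; route `SullivanDual`, crux
`Summit.SmoothPoincare4.SmoothPoincare4.Theses.SullivanDual.WitnessCharge`; line `Sketch`,
stub `helper_univalentOfDecay` — univalence near infinity from decay)

**Univalence near infinity from decay.** Let `Z : ℂ → ℂ` be complex differentiable on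
`{r₁ < ‖ξ‖}` (`0 < r₁`) and write `Z ξ = ξ + g ξ` with the decay estimates
`‖g ξ‖ ≤ C / ‖ξ‖` and `‖deriv Z ξ - 1‖ ≤ C / ‖ξ‖ ^ 2` for `r₁ ≤ ‖ξ‖` (these are produced by the
neighbouring decay stub; here they are hypotheses). Then for a suitable radius `r' ≥ r₁` the map
`Z` is co-Lipschitz with constant `2` on `{r' < ‖ξ‖}` (in particular injective there) and its
image of `{r' < ‖ξ‖}` contains the neighbourhood `{2 r' < ‖z‖}` of infinity.

Proof. Put `A = |C| ≥ 0` and `r' = 2 r₁ + 8 A + 1`, so that `r' ≥ 2 r₁`, `r' ≥ 1` and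
`8 A ≤ r' ≤ r' ^ 2`.
* Mean value step (`norm_sub_sub_le_half_mul_of_segment_subset`): if the segment `[ξ, ξ']` lies
  in `{r' / 2 < ‖·‖} ⊆ {r₁ < ‖·‖}`, then `g = Z - id` has derivative `deriv Z x - 1` along it, of
  norm `≤ A / ‖x‖ ^ 2 ≤ 4 A / r' ^ 2 ≤ 1 / 2`, so `‖g ξ - g ξ'‖ ≤ ‖ξ - ξ'‖ / 2`
  (`Convex.norm_image_sub_le_of_norm_hasDerivWithin_le` on the convex segment).
* Co-Lipschitz: for `‖ξ‖, ‖ξ'‖ > r'`, either `‖ξ - ξ'‖ < r' / 2`, and then every point of the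
  segment has norm `> r' - r' / 2 = r' / 2` and the mean value step applies, or
  `‖ξ - ξ'‖ ≥ r' / 2`, and then `‖g ξ - g ξ'‖ ≤ 2 A / r' ≤ r' / 4 ≤ ‖ξ - ξ'‖ / 2` directly. In both
  cases `‖ξ - ξ'‖ ≤ ‖Z ξ - Z ξ'‖ + ‖g ξ - g ξ'‖ ≤ ‖Z ξ - Z ξ'‖ + ‖ξ - ξ'‖ / 2`.
* Surjectivity: for `‖z‖ > 2 r'` the map `T ξ = z - g ξ` sends the closed disc
  `D = closedBall z (r' / 2) ⊆ {r' < ‖·‖}` into itself (`‖g ξ‖ ≤ A / r' ≤ r' / 8`) and is a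
  `1/2`-contraction there (mean value step, `D` convex), so the Banach fixed point theorem on the
  complete set `D` (`ContractingWith.exists_fixedPoint'`) gives `ξ ∈ D` with `T ξ = ξ`, i.e.
  `Z ξ = z`.
-/

noncomputable section

-- the registered namespace `Summit.SmoothPoincare4.SmoothPoincare4.…` repeats a component
set_option linter.dupNamespace false

open Set Filter Topology Metric

namespace Summit.SmoothPoincare4.SmoothPoincare4.Theorems.WitnessCharge.PencilIncompleteness

/-- **Mean value step.** If `Z` is complex differentiable on `{r₁ < ‖ξ‖}` with
`‖deriv Z ξ - 1‖ ≤ A / ‖ξ‖ ^ 2` for `r₁ ≤ ‖ξ‖`, and `2 r₁ ≤ r'`, `0 < r'`, `8 A ≤ r' ^ 2`, then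
along any segment contained in `{r' / 2 < ‖·‖}` the perturbation `g = Z - id` is `1/2`-Lipschitz:
`‖(Z ξ - ξ) - (Z ξ' - ξ')‖ ≤ ‖ξ - ξ'‖ / 2`. -/
theorem norm_sub_sub_le_half_mul_of_segment_subset {Z : ℂ → ℂ} {A r₁ r' : ℝ}
    (hZ : DifferentiableOn ℂ Z {ξ : ℂ | r₁ < ‖ξ‖})
    (hder : ∀ ξ : ℂ, r₁ ≤ ‖ξ‖ → ‖deriv Z ξ - 1‖ ≤ A / ‖ξ‖ ^ 2)
    (hr : 2 * r₁ ≤ r') (hr₀ : 0 < r') (hA : 8 * A ≤ r' ^ 2) {ξ ξ' : ℂ}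
    (hseg : segment ℝ ξ ξ' ⊆ {x : ℂ | r' / 2 < ‖x‖}) :
    ‖(Z ξ - ξ) - (Z ξ' - ξ')‖ ≤ 1 / 2 * ‖ξ - ξ'‖ := by
  have hU : IsOpen {ξ : ℂ | r₁ < ‖ξ‖} := isOpen_lt continuous_const continuous_norm
  have hf : ∀ x ∈ segment ℝ ξ ξ',
      HasDerivWithinAt (fun y : ℂ => Z y - y) (deriv Z x - 1) (segment ℝ ξ ξ') x := by
    intro x hx
    have hx' : r' / 2 < ‖x‖ := hseg hx
    have hxU : x ∈ {ξ : ℂ | r₁ < ‖ξ‖} := by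
      show r₁ < ‖x‖
      linarith
    exact ((hZ.differentiableAt (hU.mem_nhds hxU)).hasDerivAt.sub
      (hasDerivAt_id' x)).hasDerivWithinAt
  have hbound : ∀ x ∈ segment ℝ ξ ξ', ‖deriv Z x - 1‖ ≤ 1 / 2 := by
    intro x hx
    have hx' : r' / 2 < ‖x‖ := hseg hx
    have hx₁ : r₁ ≤ ‖x‖ := by linarith
    have hxpos : 0 < ‖x‖ := by linarith
    refine (hder x hx₁).trans ?_
    rw [div_le_iff₀ (by positivity)]
    have h2 : (r' / 2) * (r' / 2) < ‖x‖ * ‖x‖ :=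
      mul_lt_mul'' hx' hx' (by positivity) (by positivity)
    nlinarith
  exact Convex.norm_image_sub_le_of_norm_hasDerivWithin_le hf hbound (convex_segment ξ ξ')
    (right_mem_segment ℝ ξ ξ') (left_mem_segment ℝ ξ ξ')

/-- **Univalence near infinity from decay.** Let `Z` be complex differentiable on `{r₁ < ‖ξ‖}`
(`0 < r₁`) with `‖Z ξ - ξ‖ ≤ C / ‖ξ‖` and `‖deriv Z ξ - 1‖ ≤ C / ‖ξ‖ ^ 2` for `r₁ ≤ ‖ξ‖`. Then there
is a radius `r' ≥ r₁` such that `Z` is co-Lipschitz with constant `2` on `{r' < ‖ξ‖}`,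
`‖ξ - ξ'‖ ≤ 2 ‖Z ξ - Z ξ'‖` (so `Z` is injective there), and `Z '' {r' < ‖ξ‖} ⊇ {2 r' < ‖z‖}`.
The radius `r' = 2 r₁ + 8 |C| + 1` works: the perturbation `Z - id` is a `1/2`-contraction far out
(mean value inequality for nearby points, the decay bound for distant ones), and surjectivity onto
`{2 r' < ‖z‖}` is the Banach fixed point theorem for `ξ ↦ z - (Z ξ - ξ)` on
`closedBall z (r' / 2)`. -/
theorem helper_univalentOfDecay :
    ∀ (Z : ℂ → ℂ) (C r₁ : ℝ), 0 < r₁ → DifferentiableOn ℂ Z {ξ : ℂ | r₁ < ‖ξ‖} →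
      (∀ ξ : ℂ, r₁ ≤ ‖ξ‖ → ‖Z ξ - ξ‖ ≤ C / ‖ξ‖ ∧ ‖deriv Z ξ - 1‖ ≤ C / ‖ξ‖ ^ 2) →
      ∃ r' : ℝ, r₁ ≤ r' ∧
        (∀ ξ ξ' : ℂ, r' < ‖ξ‖ → r' < ‖ξ'‖ → ‖ξ - ξ'‖ ≤ 2 * ‖Z ξ - Z ξ'‖) ∧
        {z : ℂ | 2 * r' < ‖z‖} ⊆ Z '' {ξ : ℂ | r' < ‖ξ‖} := by
  intro Z C r₁ hr₁ hZ hdec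
  -- decay with the nonnegative constant `|C|`
  have hA₀ : 0 ≤ |C| := abs_nonneg C
  have hg : ∀ ξ : ℂ, r₁ ≤ ‖ξ‖ → ‖Z ξ - ξ‖ ≤ |C| / ‖ξ‖ := fun ξ hξ =>
    (hdec ξ hξ).1.trans (div_le_div_of_nonneg_right (le_abs_self C) (norm_nonneg ξ))
  have hder : ∀ ξ : ℂ, r₁ ≤ ‖ξ‖ → ‖deriv Z ξ - 1‖ ≤ |C| / ‖ξ‖ ^ 2 := fun ξ hξ =>
    (hdec ξ hξ).2.trans (div_le_div_of_nonneg_right (le_abs_self C) (by positivity))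
  -- the radius `r' = 2 r₁ + 8 |C| + 1`
  obtain ⟨r', hr'_def⟩ : ∃ r' : ℝ, r' = 2 * r₁ + 8 * |C| + 1 := ⟨_, rfl⟩
  have hr₁' : 2 * r₁ ≤ r' := by linarith
  have hr'₀ : 0 < r' := by linarith
  have hAr : 8 * |C| ≤ r' ^ 2 := by nlinarith
  have hg' : ∀ ξ : ℂ, r' < ‖ξ‖ → ‖Z ξ - ξ‖ ≤ r' / 8 := by
    intro ξ hξ
    have hξ₁ : r₁ ≤ ‖ξ‖ := by linarith
    refine (hg ξ hξ₁).trans ?_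
    rw [div_le_iff₀ (by linarith)]
    nlinarith
  -- the contraction estimate along segments far out
  have key : ∀ ξ ξ' : ℂ, segment ℝ ξ ξ' ⊆ {x : ℂ | r' / 2 < ‖x‖} →
      ‖(Z ξ - ξ) - (Z ξ' - ξ')‖ ≤ 1 / 2 * ‖ξ - ξ'‖ := fun ξ ξ' hseg =>
    norm_sub_sub_le_half_mul_of_segment_subset hZ hder hr₁' hr'₀ hAr hseg
  refine ⟨r', by linarith, ?_, ?_⟩
  · -- co-Lipschitz estimate
    intro ξ ξ' hξ hξ'
    have hcontr : ‖(Z ξ - ξ) - (Z ξ' - ξ')‖ ≤ 1 / 2 * ‖ξ - ξ'‖ := by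
      rcases lt_or_ge ‖ξ - ξ'‖ (r' / 2) with h | h
      · refine key ξ ξ' fun x hx => ?_
        have hxball := segment_subset_closedBall_left ξ ξ' hx
        rw [mem_closedBall, dist_eq_norm, dist_eq_norm] at hxball
        have := norm_sub_norm_le ξ x
        rw [norm_sub_rev] at this
        show r' / 2 < ‖x‖
        linarith
      · calc ‖(Z ξ - ξ) - (Z ξ' - ξ')‖ ≤ ‖Z ξ - ξ‖ + ‖Z ξ' - ξ'‖ := norm_sub_le _ _
          _ ≤ r' / 8 + r' / 8 := add_le_add (hg' ξ hξ) (hg' ξ' hξ')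
          _ ≤ 1 / 2 * ‖ξ - ξ'‖ := by linarith
    have htri : ‖ξ - ξ'‖ ≤ ‖Z ξ - Z ξ'‖ + ‖(Z ξ - ξ) - (Z ξ' - ξ')‖ :=
      calc ‖ξ - ξ'‖ = ‖(Z ξ - Z ξ') - ((Z ξ - ξ) - (Z ξ' - ξ'))‖ := by congr 1; ring
        _ ≤ ‖Z ξ - Z ξ'‖ + ‖(Z ξ - ξ) - (Z ξ' - ξ')‖ := norm_sub_le _ _
    linarith
  · -- surjectivity onto `{2 r' < ‖z‖}`: Banach fixed point on `closedBall z (r' / 2)`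
    intro z hz
    have hz : 2 * r' < ‖z‖ := hz
    have hDnorm : ∀ ξ ∈ closedBall z (r' / 2), r' < ‖ξ‖ := by
      intro ξ hξ
      rw [mem_closedBall, dist_eq_norm] at hξ
      have := norm_sub_norm_le z ξ
      rw [norm_sub_rev] at this
      linarith
    obtain ⟨T, hT⟩ : ∃ T : ℂ → ℂ, ∀ ξ, T ξ = z - (Z ξ - ξ) := ⟨_, fun _ => rfl⟩
    have hmaps : MapsTo T (closedBall z (r' / 2)) (closedBall z (r' / 2)) := by
      intro ξ hξ
      have hξ' := hDnorm ξ hξ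
      rw [mem_closedBall, dist_eq_norm, hT, sub_sub_cancel_left, norm_neg]
      linarith [hg' ξ hξ']
    have hcontr : ContractingWith (1 / 2) (hmaps.restrict T _ _) := by
      refine ⟨by norm_num, LipschitzWith.of_dist_le_mul fun x y => ?_⟩
      rw [Subtype.dist_eq, MapsTo.val_restrict_apply, MapsTo.val_restrict_apply, dist_eq_norm,
        Subtype.dist_eq, dist_eq_norm]
      have hseg : segment ℝ (x : ℂ) y ⊆ {w : ℂ | r' / 2 < ‖w‖} := fun w hw => by
        have hw' := hDnorm w ((convex_closedBall z (r' / 2)).segment_subset x.2 y.2 hw)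
        show r' / 2 < ‖w‖
        linarith
      have hTT : T x - T y = -((Z x - x) - (Z y - y)) := by rw [hT, hT]; ring
      rw [hTT, norm_neg]
      push_cast
      exact key x y hseg
    obtain ⟨y, hyD, hfix, -⟩ := ContractingWith.exists_fixedPoint' isClosed_closedBall.isComplete
      hmaps hcontr (mem_closedBall_self (by positivity)) (edist_ne_top _ _)
    refine ⟨y, hDnorm y hyD, ?_⟩
    have h := hfix.eq
    rw [hT] at h
    linear_combination -h

end Summit.SmoothPoincare4.SmoothPoincare4.Theorems.WitnessCharge.PencilIncompleteness
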